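import Mathlib
import HarnessLib
import HarnessLib.Audit
import Summits.QuantumAdvantage.Statement
import Literature.Computability.Complexity.CircuitClasses
import HarnessLib.Audit.Status.Attr

/-!
Route: YangBaxterIslands

DORMANT since 2026-08-23T06:22:12Z (reconciler: no traction for 5.9 d (last activity statement-grounded at 2026-08-17T07:04:27Z); parked, not closed — `ledger route dormant route-QuantumAdvantage-YangBaxterIslands --off` to reactivate) — unstaffed, not closed; items shared with open routes are served there. `ledger route dormant <id> --off` reactivates.

# Route QuantumAdvantage/YangBaxterIslands — is the Bethe ansatz a dequantization algorithm, or is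
the integrable XXZ brickwork a universal computer? (idea card yang-baxter-islands)

## Thesis X
Words: some language decided by a HOMOGENEOUS, YANG–BAXTER-INTEGRABLE XXZ BRICKWORK circuit family
is not in BPP. The family: one fixed two-qubit gate U(a,b) = exp(-i(aπ(X⊗X+Y⊗Y) + bπ Z⊗Z)), a, b ∈
ℚ, laid as an open-chain brickwork (layer s acts on bonds (j,j+1), j ≡ s mod 2) of polynomial depth
q(|y|) on |y| + p(|y|) wires, run on the computational product state |y⟩|0…0⟩ with y = f(x) for a
deterministic poly-time encoder f ∈ FP (the program lives in the initial state, nowhere else), wire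
0 measured, error ≤ 1/3. Call the class of languages so decided XXZBQP (P ⊆ XXZBQP ⊆ BQP). Every
such circuit is an integrable Trotterization: U(a,b) is the braid-form six-vertex Ř-matrix with
anisotropy Δ = sin 2bπ / sin 2aπ and the brickwork Floquet operator is generated by commuting
transfer matrices (LjubotinaZadnikProsen2019 eq. for U_{n,n+1} and App. B; VanicatZadnikProsen2018).
Lean (route decl YbTarget; the class is inlined verbatim, definition request IntegrableBrickwork
mirrors it): `∃ L : Language Bool, L ∈ XXZBQP ∧ L ∉ Literature.Computability.Complexity.BPP`.

## Assembly
`YbMembership → YbTarget → QuantumAdvantage` with YbMembership : XXZBQP ⊆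
Literature.Computability.Cryptography.BQP (compile the fixed algebraic gate into Clifford+T, run f
reversibly; BQPWith_subset_BQPWith_of_compiler + P ⊆ BQP plumbing). One line of logic; X is a
STRENGTHENING of S that crux YbHardness (BQP ⊆ XXZBQP: the integrable brickwork is a programmable
universal computer) makes EQUIVALENT to S (YbHardnessTransfer : YbHardness → QuantumAdvantage →
YbTarget), while crux YbIsland (XXZBQP ⊆ BPP) is literally ¬X. The route is a FORK on one uniform
family: exactly one of {Hardness, Island} is expected, and either is a theorem nobody has.

Rationale: ## Why this line
The tree's BQP is a circuit class, and the only interacting circuit families with an exact infinite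
symmetry are the Yang–Baxter ones: a brickwork of ONE fixed XXZ gate is an integrable Floquet
dynamics for every (a,b) (LjubotinaZadnikProsen2019 App. B; VanicatZadnikProsen2018), interpolating
between provably classical lines — b ∈ ½ℤ: matchgates/free fermions (Valiant2002,
TerhalDivincenzo2002, JozsaMiyake2008); a ∈ ¼+½ℤ: the dual-unitary line, gate = SWAP·(diagonal
phase), basis states go to basis states (dual-unitary circuits are the resolved island-vs-universal
precedent, SuzukiMitaraiFujii2022); a ∈ ½ℤ: diagonal gate — and genuinely interacting points (a = b
= 1/8 is a Trotterized Heisenberg chain of partial swaps). Imported area: quantum integrability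
(Bethe ansatz, factorized scattering, GHD) and tensor networks (operator entanglement:
AlbaDubailMedenjak2019, JacobyGopalakrishnan2026; tMPS: CarignanoMarimonTagliacozzo2024; TT ranks:
Oseledets2011), pointed at ONE uniform family whose decision power is open on both sides. The
dictionary is literal, not an analogy: gate = Ř-matrix, depth = Trotter time, input string = initial
product state, wire-0 acceptance = ⟨z|U†P₀U|z⟩.

## Ranked cruxes
2. YbDiagTT (engine, matrix-level, numerically falsifiable): the wire-0 acceptance function z ↦
⟨z|U_t†P₀U_t|z⟩ on {0,1}^N has a sup-norm 1/(e+1)-approximate tensor train of bond dimension and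
entry height poly(N,t,e). Exact rank 2 on the free line, rank 1 on the trivial lines; poly(t) for
diagonal operators in Rule 54 (JacobyGopalakrishnan2026 §2.3); OPEN at interacting XXZ points, and
JG26 §3 argue VOLUME-LAW operator entanglement at late times t ≫ N for Heisenberg — the first thing
a refuter should compute (N ≈ 14, t ∈ {N/2, N, 4N}, a = b = 1/8).
3. YbHardness: BQP ⊆ XXZBQP — programmable universality of an INTEGRABLE qubit QCA (program+data in
the product input; cf. VollbrechtCirac2008 for designed non-integrable TI dynamics,
ChildsGossetWebb2013 for scattering-phase universality on graphs, Zhang2012/KauffmanLomonaco2004 for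
Ř-matrices as gates WITH local unitaries). Makes X ⟺ S.
4. YbIsland: XXZBQP ⊆ BPP (= ¬X): worst-case dequantization of every rational integrable brickwork
at polynomial depth — "the Bethe ansatz as a BPP algorithm". Hardness ∧ Island ⟹ BQP ⊆ BPP, so the
horns exclude each other modulo ¬S.
Support: YbMembership (⊆ BQP), YbHardnessTransfer, YbDiagTTToPPoly (DiagTT ⟹ XXZBQP ⊆ P/poly: cores
as advice), YbFreeFermionLine (b ∈ ½ℤ ⟹ ⊆ P), YbTrivialLines (a ∈ ½ℤ ∪ ¼+½ℤ ⟹ ⊆ P) — the last two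
calibrate the inlined definitions and are provable now.

## Kill criteria
YbIsland proved (all rational (a,b)) ⟹ X refuted ⟹ close `refuted:YbTarget` with the dequantization
theorem as census (a result in itself). YbDiagTT refuted numerically at an interacting point for t ≤
N ⟹ drop the tensor-network engine, keep Island only if a Bethe-ansatz (non-TN) algorithm is
proposed, else demote the route to the Hardness horn. YbHardness refuted for a structural reason
(e.g. a proof that phase-only factorized scattering with Z-readout yields IQP-type marginals,
BremnerJozsaShepherd2011 Thm 3 analogue) ⟹ X loses its equivalence with S; close unless Island is
within reach.

## Deliberately NOT decomposed
Early/late regime split of DiagTT and Island (t ≤ N vs t ≫ N, JacobyGopalakrishnan2026 §4.2);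
periodic-boundary variant (VZP18's literal model); inhomogeneous-angle universality (site-dependent
(a_j,b_j): standard encoded universality, the calibration that homogeneity = integrability is the
tested obstruction); algebraic/computable angles beyond ℚπ; operator-entanglement (2-norm)
statements, which control only average-case inputs.

NOVELTY and BARRIERS: see the dedicated fields (searched: card audit refs + crossref this session;
lit searchd/galaxy unavailable 10:48–11:30Z, recorded in NOTES).

Novelty: NOVELTY (searched: the card's own audit refs (refuter grades 2026-08-15, prior arXiv:2307.11649,
arXiv:1901.04521, doi:10.1007/s11128-012-0409-4, arXiv:quant-ph/0401090, arXiv:1712.00431,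
doi:10.22331/q-2022-01-24-631); this session crossref title searches for the family, operator
entanglement, matchgates, IQP marginals, multiparticle-walk universality, TT decompositions; `lit
frontier QuantumAdvantage --since 2021` and `lit bridges QuantumAdvantage --cross any` (no
integrability hits); `lean search`
XXZ|sixVertex|YangBaxter|matchgate|brickwork|operatorEntanglement|tensorTrain (nothing in the tree
beyond SAW Yang–Baxter combinatorics); lit searchd/galaxy/arXiv/S2/OpenAlex were unavailable or
rate-limited, logged).
Nearest prior art: (1) the FAMILY is the integrable Trotterization of VanicatZadnikProsen2018 =
arXiv:1712.00431 and LjubotinaZadnikProsen2019 = arXiv:1901.05398 (p.3: the gate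
exp(-iτ(XX+YY)-iτ'(ZZ-1)) is the braid XXZ R-matrix; App. B: commuting transfer matrices, T(-)⁻¹T(+)
= U_odd U_even), studied for transport, never for decision complexity; (2) the ISLAND engine in
2-norm form is stated conditionally by CarignanoMarimonTagliacozzo2024 = arXiv:2307.11649 (log
operator entanglement ⟹ efficient tMPS for local operators) on the evidence of
AlbaDubailMedenjak2019 = arXiv:1901.04521, and JacobyGopalakrishnan2026 = arXiv:2503.09578 prove the
log bound for DIAGONAL operators in Rule 54 (p.31 eq. (10), χ ~ t²) while arguing volume law at late
times for Heisenberg (p.36  [refs: 10.1007/s11128-012-0409-4, 10.22331/q-2022-01-24-631, 2307.11649, 1901.04521, quant-ph/0401090, 1712.00431, 1901.05398, 2503.09578, 0704.3432, doi:10.1007/s11128-012-0409-4, doi:10.22331/q-2022-01-24-631, VanicatZadnikProsen2018, LjubotinaZadnikProsen2019, CarignanoMarimonTagliacozzo2024, AlbaDubailMedenjak2019, JacobyGopalakrishnan2026, Zhang2012, KauffmanLomonaco2004, VollbrechtCirac2008, Childs]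

Barriers (technique_class: integrability, tensor-networks, simulation, non-black-box): technique_class: integrability, tensor-networks, simulation, non-black-box (also: dequantization,
programmable-QCA universality)
- Literature.Barriers.QuantumAdvantage.Relativization: shares the token `simulation` but not the
class — every item here is about an EXPLICIT gate family (one algebraic 4×4 gate, brickwork
placements), consumed gate by gate: YbIsland/YbDiagTT are white-box tensor-network/Bethe-ansatz
simulations with no counterpart for an oracle gate (an oracle placement destroys both the
Yang–Baxter structure and any bond-dimension bound), and YbHardness is a compilation INTO the
family; nothing is of the shape O ↦ (BQP^O vs BPP^O). The target X itself inherits the summit's need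
for a non-relativizing proof (X ⟹ S); the route does not claim to prove X, it makes X equivalent to
S (YbHardness) or refutes it (YbIsland).
- Literature.Barriers.QuantumAdvantage.PPolyOracles: shares `non-black-box` only lexically — no
oracle, no P/poly-oracle separation, no sampling claim; YbDiagTTToPPoly concludes an INCLUSION
XXZBQP ⊆ P/poly (advice = tensor-train cores), the opposite direction of what AaronsonChen2017 Thm
8.1 constrains.
- Literature.Barriers.QuantumAdvantage.Algebrization: not engaged (no arithmetization, no
interactive proof; same white-box status as Relativization).
- Literature.Barriers.QuantumAdvantage.SeparationPrerequisites: APPLIES to the target X in full (X ⟹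
∃ L ∈ BQP ∖ BPP ⟹ PP ⊄ BPP, P ≠ PSPACE) and is NOT evaded: X is never staffed for a direct proof;
the

History (route lifecycle, newest last):
- 2026-08-16T04:15:27Z · AUTO-CRUX (backfill): YbTarget — hypotheses of the deciding theorem that nothing in the route derives are cruxes (operator:999:1085951)
- 2026-08-23T06:22:12Z · DORMANT — reconciler: no traction for 5.9 d (last activity statement-grounded at 2026-08-17T07:04:27Z); parked, not closed — `ledger route dormant route-QuantumAdvantage- (operator:999:3219986)

sub-problem: QuantumAdvantage · status: dormant · opened planner-plancard-QuantumAdvantage-QuantumAdva-0b621bbd-0 2026-08-15T11:05:29Z · rev 2 · ledger route-QuantumAdvantage-YangBaxterIslands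
GENERATED by the gate from the ledger (D-0016/17). Provers cite these decls: `theorem foo : Summit.QuantumAdvantage.QuantumAdvantage.Theses.YangBaxterIslands.<Decl> := …` in Summits/QuantumAdvantage/QuantumAdvantage/Theorems/<Name>.lean.
-/

namespace Summit.QuantumAdvantage.QuantumAdvantage.Theses.YangBaxterIslands

open scoped BigOperators Topology Manifold Classical MeasureTheory ProbabilityTheory Matrix InnerProductSpace ComplexConjugate ContinuousMap
open Filter Set Function TopologicalSpace MeasureTheory

attribute [summit_statement] _root_.QuantumAdvantage

open Literature.QuantumAdvantage

/-- item stmt-QuantumAdvantage-2545 · crux (kind.auto-crux: conjecture-grade) · rank 0 · open · by planner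
why it might fail: Summit-strength (X ⟹ BQP ⊄ BPP ⟹ P ≠ PP, P ≠ PSPACE: Literature.Barriers.QuantumAdvantage.SeparationPrerequisites), never for direct proof; X is FALSE iff YbIsland — free line b ∈ ½ℤ ⊆ P (matchgates), a ∈ ½ℤ ∪ ¼+½ℤ trivial, early-time log-LOE hints interacting points may dequantize too.
sources: VanicatZadnikProsen2018, LjubotinaZadnikProsen2019, Valiant2002, JozsaMiyake2008, AlbaDubailMedenjak2019, JacobyGopalakrishnan2026
[target] Thesis X of route YangBaxterIslands: some language decided (error ≤ 1/3, wire 0) by a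
homogeneous Yang–Baxter-integrable XXZ brickwork family with rational angles, polynomial
depth/ancillas and a poly-time input encoding lies outside BPP. [Objects, inlined verbatim in every
signature; definition request IntegrableBrickwork mirrors them] U(a,b) := exp(-i(aπ(X⊗X+Y⊗Y)+bπ
Z⊗Z)) (rows/cols indexed by Fin 2 → Bool; |00⟩,|11⟩ ↦ e^{-ibπ}, odd block e^{ibπ}[[cos 2aπ, -i sin
2aπ],[-i sin 2aπ, cos 2aπ]]); gate set ⟨Unit, 2, U(a,b)⟩; brickwork(N,t) := layers s < t, layer s =
gate on bonds (j,j+1) with j ≡ s mod 2, j+1 < N (open chain); family F(a,b,p,q) := ⟨p.eval, n ↦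
brickwork(n + p n, q n)⟩ : QCircuitFamily; XXZBQP := {L | ∃ a b : ℚ, ∃ f ∈ FP, ∃ p q : ℕ[X], ∀ x,
F.acceptProbOn 0 (f x) ≥ 2/3 if x ∈ L, ≤ 1/3 if x ∉ L} (run on |f x⟩|0^{p|f x|}⟩, wire 0 measured).
Integrability: U(a,b) is the braid six-vertex Ř-matrix, anisotropy Δ = sin 2bπ / sin 2aπ
(LjubotinaZadnikProsen2019 p.3 and App. B). X ⟹ S via YbMembership (one line, YbAssembly);
YbHardness makes X ⟺ S (YbHardnessTransfer); YbIsland is literally ¬X. [VanicatZadnikProsen2018;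
LjubotinaZadnikProsen2019; card yang-baxter-island -/
@[route_item "route-QuantumAdvantage-YangBaxterIslands", crux]
def YbTarget : Prop :=
  ∃ L : Language Bool, (∃ a b : ℚ, ∃ (f : List Bool → List Bool) (p q : Polynomial ℕ), f ∈ Literature.Computability.Complexity.FP ∧ ∃ F : Literature.Computability.Cryptography.QCircuitFamily (⟨Unit, fun _ => 2, fun _ => Matrix.of fun u v : Fin 2 → Bool => if u 0 = u 1 then (if v = u then Complex.exp (-((((b : ℝ) * Real.pi) : ℝ) : ℂ) * Complex.I) else 0) else if v 0 = v 1 then 0 else Complex.exp (((((b : ℝ) * Real.pi) : ℝ) : ℂ) * Complex.I) * (if v = u then ((Real.cos (2 * ((a : ℝ) * Real.pi)) : ℝ) : ℂ) else -(Complex.I * ((Real.sin (2 * ((a : ℝ) * Real.pi)) : ℝ) : ℂ)))⟩ : Literature.Computability.Cryptography.QGateSet), F = ⟨fun n => p.eval n, fun n => ⟨(List.range (q.eval n)).flatMap fun s => (List.range (n + p.eval n)).filterMap fun j => if h : j % 2 = s % 2 ∧ j + 1 < (n + p.eval n) then some (Literature.Computability.Cryptography.QGate.gate () ⟨fun i :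 Fin 2 => ⟨j + i.val, by have := i.isLt; omega⟩, fun i i' hh => Fin.ext (by simp only [Fin.mk.injEq] at hh; omega)⟩) else none⟩⟩ ∧ ∀ x : List Bool, (x ∈ L → (2 : ℝ) / 3 ≤ F.acceptProbOn 0 (f x)) ∧ (x ∉ L → F.acceptProbOn 0 (f x) ≤ 1 / 3)) ∧ L ∉ Literature.Computability.Complexity.BPP

/-- item stmt-QuantumAdvantage-2547 · crux · rank 2 · open · by planner
why it might fail: JG26 (arXiv:2503.09578 §3.2, Fig. 6) conjecture VOLUME-LAW von Neumann LOE for the Heisenberg chain at t ≫ N; if the sup-norm ε-rank of the wire-0 diagonal inherits it, D ≤ poly(N+t+e) fails at interacting (a,b) once q(n) ≳ n (exact rank 2^{min(t+1,N)/2}); dilute-magnon inputs are likely witnesses.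
sources: JacobyGopalakrishnan2026, arXiv:2503.09578, AlbaDubailMedenjak2019, arXiv:1901.04521, CarignanoMarimonTagliacozzo2024, arXiv:2307.11649
[crux] ENGINE of the island horn, matrix-level and numerically falsifiable. For all rational (a,b)
there is a polynomial r such that for all N ≥ 1, t, e the wire-0 acceptance function of the depth-t
brickwork on N wires with NO ancillas, z ↦ p(z) := ⟨z|U_t† P₀ U_t|z⟩ (= acceptProb on input z : Fin
N → Bool; P₀ = |1⟩⟨1| on wire 0), admits a TENSOR TRAIN (MPS of a function, Oseledets2011) p̃(z) =
(G_0(z_0) G_1(z_1) ⋯ G_{N-1}(z_{N-1}))_{00} with real D+1 × D+1 cores, D ≤ r(N+t+e), |entries| ≤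
2^{r(N+t+e)}, and SUP-norm error max_z |p(z) − p̃(z)| ≤ 1/(e+1). Known/easy cases (support-level
warm-ups a prover may land with --supports): free line b ∈ ½ℤ: p(z) = Σ_j |u_{0j}(t)|² z_j exactly
(Jordan–Wigner, U†n₀U quadratic), TT rank 2; trivial lines: rank 1; Rule 54 analogue: diagonal local
operators evolve with MPO bond dimension χ ~ t² and saturate at S ≤ 8 log₂ L
(JacobyGopalakrishnan2026 p.31 eq. (10)). OPEN at interacting points (e.g. a = b = 1/8, Trotterized
Heisenberg). Why sup norm on the DIAGONAL: 2-norm operator entanglement (Prosen–Pižorn,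
AlbaDubailMedenjak2019, CarignanoMarimonTagliacozzo2024) controls ⟨z|O|z⟩ only for most z, useless
for structured inputs f(x); the diagonal in -/
@[route_item "route-QuantumAdvantage-YangBaxterIslands"]
def YbDiagTT : Prop :=
  ∀ a b : ℚ, ∃ r : Polynomial ℕ, ∀ N t e : ℕ, 0 < N → ∃ D : ℕ, D ≤ r.eval (N + t + e) ∧ ∃ G : Fin N → Bool → Matrix (Fin (D + 1)) (Fin (D + 1)) ℝ, (∀ j c i k, |G j c i k| ≤ 2 ^ r.eval (N + t + e)) ∧ ∀ z : Fin N → Bool, |(⟨(List.range t).flatMap fun s => (List.range (N + 0)).filterMap fun j => if h : j % 2 = s % 2 ∧ j + 1 < (N + 0) then some (Literature.Computability.Cryptography.QGate.gate () ⟨fun i : Fin 2 => ⟨j + i.val, by have := i.isLt; omega⟩, fun i i' hh => Fin.ext (by simp only [Fin.mk.injEq] at hh; omega)⟩) else none⟩ : Literature.Computability.Cryptography.QCircuit (⟨Unit, fun _ => 2, fun _ => Matrix.of fun u v : Fin 2 → Bool => if u 0 = u 1 then (if v = u then Complex.exp (-((((b : ℝ) * Real.pi) : ℝ) : ℂ)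 * Complex.I) else 0) else if v 0 = v 1 then 0 else Complex.exp (((((b : ℝ) * Real.pi) : ℝ) : ℂ) * Complex.I) * (if v = u then ((Real.cos (2 * ((a : ℝ) * Real.pi)) : ℝ) : ℂ) else -(Complex.I * ((Real.sin (2 * ((a : ℝ) * Real.pi)) : ℝ) : ℂ)))⟩ : Literature.Computability.Cryptography.QGateSet) (N + 0)).acceptProb 0 z - ((List.ofFn fun j => G j (z j)).prod) 0 0| ≤ 1 / ((e : ℝ) + 1)

/-- item stmt-QuantumAdvantage-2548 · crux · rank 3 · open · by planner
why it might fail: No programmable-universal 1D QCA of QUBITS with one fixed n.n. gate is known even without integrability (arXiv:1904.13318 §4: Raussendorf05 = designed 2D rule, SFW06 needs d=12); here scattering is factorized, reflectionless, phase-only (no routing), Z-readout phase-blind; Ř-gates need local gates.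
sources: arXiv:1904.13318, KauffmanLomonaco2004, Zhang2012, VollbrechtCirac2008, arXiv:0802.0886, ChildsGossetWebb2013
[crux] HARDNESS HORN: BQP ⊆ XXZBQP — every language decided by a uniform Clifford+T family is
decided by SOME rational-angle homogeneous integrable XXZ brickwork after a poly-time classical
encoding f of the input into the initial product state (program + data + clock written as a bit
string; the dynamics is fixed). I.e. the integrable qubit QCA is a programmable universal quantum
computer with single-wire readout. [Objects, inlined verbatim in every signature; definition request
IntegrableBrickwork mirrors them] U(a,b) := exp(-i(aπ(X⊗X+Y⊗Y)+bπ Z⊗Z)) (rows/cols indexed by Fin 2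
→ Bool; |00⟩,|11⟩ ↦ e^{-ibπ}, odd block e^{ibπ}[[cos 2aπ, -i sin 2aπ],[-i sin 2aπ, cos 2aπ]]); gate
set ⟨Unit, 2, U(a,b)⟩; brickwork(N,t) := layers s < t, layer s = gate on bonds (j,j+1) with j ≡ s
mod 2, j+1 < N (open chain); family F(a,b,p,q) := ⟨p.eval, n ↦ brickwork(n + p n, q n)⟩ :
QCircuitFamily; XXZBQP := {L | ∃ a b : ℚ, ∃ f ∈ FP, ∃ p q : ℕ[X], ∀ x, F.acceptProbOn 0 (f x) ≥ 2/3
if x ∈ L, ≤ 1/3 if x ∉ L} (run on |f x⟩|0^{p|f x|}⟩, wire 0 measured). Integrability: U(a,b) is the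
braid six-vertex Ř-matrix, anisotropy Δ = sin 2bπ / sin 2aπ (LjubotinaZadnikProsen2019 p.3 and App.
B). Engines on offer: magno -/
@[route_item "route-QuantumAdvantage-YangBaxterIslands"]
def YbHardness : Prop :=
  Literature.Computability.Cryptography.BQP ⊆ {L : Language Bool | ∃ a b : ℚ, ∃ (f : List Bool → List Bool) (p q : Polynomial ℕ), f ∈ Literature.Computability.Complexity.FP ∧ ∃ F : Literature.Computability.Cryptography.QCircuitFamily (⟨Unit, fun _ => 2, fun _ => Matrix.of fun u v : Fin 2 → Bool => if u 0 = u 1 then (if v = u then Complex.exp (-((((b : ℝ) * Real.pi) : ℝ) : ℂ) * Complex.I) else 0) else if v 0 = v 1 then 0 else Complex.exp (((((b : ℝ) * Real.pi) : ℝ) : ℂ) * Complex.I) * (if v = u then ((Real.cos (2 * ((a : ℝ) * Real.pi)) : ℝ) : ℂ) else -(Complex.I * ((Real.sin (2 * ((a : ℝ) * Real.pi)) : ℝ) : ℂ)))⟩ : Literature.Computability.Cryptography.QGateSet), F = ⟨fun n => p.eval n, fun n => ⟨(List.range (q.eval n)).flatMap fun s => (List.range (n + p.eval n)).filterMap fun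 j => if h : j % 2 = s % 2 ∧ j + 1 < (n + p.eval n) then some (Literature.Computability.Cryptography.QGate.gate () ⟨fun i : Fin 2 => ⟨j + i.val, by have := i.isLt; omega⟩, fun i i' hh => Fin.ext (by simp only [Fin.mk.injEq] at hh; omega)⟩) else none⟩⟩ ∧ ∀ x : List Bool, (x ∈ L → (2 : ℝ) / 3 ≤ F.acceptProbOn 0 (f x)) ∧ (x ∉ L → F.acceptProbOn 0 (f x) ≤ 1 / 3)}

/-- item stmt-QuantumAdvantage-2549 · crux · rank 4 · open · by planner
why it might fail: It is ¬X, and with YbHardness it yields BQP ⊆ BPP (¬summit). Interacting integrable ≠ simulable: linear state-entanglement growth, k!-term Bethe/Yudson amplitudes, volume-law late-time LOE conjectured (JG26 §3.2); no worst-case poly-time simulation of interacting integrable dynamics is in print.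
sources: JacobyGopalakrishnan2026, arXiv:2503.09578, CarignanoMarimonTagliacozzo2024, AlbaDubailMedenjak2019, arXiv:2405.16070, Valiant2002
[crux] ISLAND HORN (negative side; literally ¬YbTarget): XXZBQP ⊆ BPP — for every rational (a,b),
every poly-time encoder f and all polynomial p, q, the wire-0 acceptance probability of the
depth-q(|f x|) integrable brickwork on |f x⟩|0^{p}⟩ can be decided (≥ 2/3 vs ≤ 1/3) by a
probabilistic poly-time machine: 'the Bethe ansatz is a dequantization algorithm'. [Objects, inlined
verbatim in every signature; definition request IntegrableBrickwork mirrors them] U(a,b) :=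
exp(-i(aπ(X⊗X+Y⊗Y)+bπ Z⊗Z)) (rows/cols indexed by Fin 2 → Bool; |00⟩,|11⟩ ↦ e^{-ibπ}, odd block
e^{ibπ}[[cos 2aπ, -i sin 2aπ],[-i sin 2aπ, cos 2aπ]]); gate set ⟨Unit, 2, U(a,b)⟩; brickwork(N,t) :=
layers s < t, layer s = gate on bonds (j,j+1) with j ≡ s mod 2, j+1 < N (open chain); family
F(a,b,p,q) := ⟨p.eval, n ↦ brickwork(n + p n, q n)⟩ : QCircuitFamily; XXZBQP := {L | ∃ a b : ℚ, ∃ f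
∈ FP, ∃ p q : ℕ[X], ∀ x, F.acceptProbOn 0 (f x) ≥ 2/3 if x ∈ L, ≤ 1/3 if x ∉ L} (run on |f x⟩|0^{p|f
x|}⟩, wire 0 measured). Integrability: U(a,b) is the braid six-vertex Ř-matrix, anisotropy Δ = sin
2bπ / sin 2aπ (LjubotinaZadnikProsen2019 p.3 and App. B). Routes to it: (i) YbDiagTT + uniformly
computable cores (the tMPS/folding algori -/
@[route_item "route-QuantumAdvantage-YangBaxterIslands"]
def YbIsland : Prop :=
  {L : Language Bool | ∃ a b : ℚ, ∃ (f : List Bool → List Bool) (p q : Polynomial ℕ), f ∈ Literature.Computability.Complexity.FP ∧ ∃ F : Literature.Computability.Cryptography.QCircuitFamily (⟨Unit, fun _ => 2, fun _ => Matrix.of fun u v : Fin 2 → Bool => if u 0 = u 1 then (if v = u then Complex.exp (-((((b : ℝ) * Real.pi) : ℝ) : ℂ) * Complex.I) else 0) else if v 0 = v 1 then 0 else Complex.exp (((((b : ℝ) * Real.pi) : ℝ) : ℂ) * Complex.I) * (if v = u then ((Real.cos (2 * ((a : ℝ) * Real.pi)) : ℝ) : ℂ) else -(Complex.I * ((Real.sin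 (2 * ((a : ℝ) * Real.pi)) : ℝ) : ℂ)))⟩ : Literature.Computability.Cryptography.QGateSet), F = ⟨fun n => p.eval n, fun n => ⟨(List.range (q.eval n)).flatMap fun s => (List.range (n + p.eval n)).filterMap fun j => if h : j % 2 = s % 2 ∧ j + 1 < (n + p.eval n) then some (Literature.Computability.Cryptography.QGate.gate () ⟨fun i : Fin 2 => ⟨j + i.val, by have := i.isLt; omega⟩, fun i i' hh => Fin.ext (by simp only [Fin.mk.injEq] at hh; omega)⟩) else none⟩⟩ ∧ ∀ x : List Bool, (x ∈ L → (2 : ℝ) / 3 ≤ F.acceptProbOn 0 (f x)) ∧ (x ∉ L → F.acceptProbOn 0 (f x) ≤ 1 / 3)} ⊆ Literature.Computability.Complexity.BPP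

/-- item stmt-QuantumAdvantage-17623 · support · rank 3 · open · by planner
[crux] PIECE 2 of the derandomization split of YbTarget: some language decided (error ≤ 1/3, wire 0)
by a rational-angle homogeneous Yang–Baxter-integrable XXZ brickwork family with an FP input
encoding (the class XXZBQP, inlined exactly as in every item of this route) is NOT in P — the thesis
YbTarget with BPP replaced by Classes.P ('the integrable brickwork beats deterministic polynomial
time'). NECESSARY for the crux: YbTarget → YbNotP (Split.notP_of_target, by the tree theorem P ⊆
BPP); strictly weaker than it (the converse is derandomization, supplied by piece 1 through IW97:
Split.YbTarget_of_subs); gives neither S nor YbTarget on its own (must-fail probes). Foreseen proof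
shape: YbHardness ∧ (BQP ⊄ P) (Split.notP_of_hardness_of_bqpNotP; skeleton Lines/birth_YbNotP.lean:
stub_hardness = route crux YbHardness, stub_bqpNotP = ∃ L ∈ BQP, L ∉ P, a consequence of S),
concrete instance FACT ∈ XXZBQP ∧ FACT ∉ P. Separation-strength jointly with YbMembership (BQP ⊄ P ⟹
P ≠ PP ⟹ P ≠ PSPACE). Refutation surface, sharper and cheaper than YbIsland: a DETERMINISTIC island
XXZBQP ⊆ P (free line b ∈ ½ℤ and trivial lines a ∈ ½ℤ ∪ ¼+½ℤ are ⊆ P already: YbFreeFermionLine,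
YbTrivialLines). why -/
@[route_item "route-QuantumAdvantage-YangBaxterIslands"]
def YbNotP : Prop :=
  ∃ L : Language Bool, (∃ a b : ℚ, ∃ (f : List Bool → List Bool) (p q : Polynomial ℕ), f ∈ Literature.Computability.Complexity.FP ∧ ∃ F : Literature.Computability.Cryptography.QCircuitFamily (⟨Unit, fun _ => 2, fun _ => Matrix.of fun u v : Fin 2 → Bool => if u 0 = u 1 then (if v = u then Complex.exp (-((((b : ℝ) * Real.pi) : ℝ) : ℂ) * Complex.I) else 0) else if v 0 = v 1 then 0 else Complex.exp (((((b : ℝ) * Real.pi) : ℝ) : ℂ) * Complex.I) * (if v = u then ((Real.cos (2 * ((a : ℝ) * Real.pi)) : ℝ) : ℂ) else -(Complex.I * ((Real.sin (2 * ((a : ℝ) * Real.pi)) : ℝ) : ℂ)))⟩ : Literature.Computability.Cryptography.QGateSet), F = ⟨fun n => p.eval n, fun n => ⟨(List.range (q.eval n)).flatMap fun s => (List.range (n + p.eval n)).filterMap fun j => if h : j % 2 = s % 2 ∧ j + 1 < (n + p.eval n) then some (Literature.Computability.Cryptography.QGate.gate () ⟨fun i : Fin 2 => ⟨j + i.val,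 by have := i.isLt; omega⟩, fun i i' hh => Fin.ext (by simp only [Fin.mk.injEq] at hh; omega)⟩) else none⟩⟩ ∧ ∀ x : List Bool, (x ∈ L → (2 : ℝ) / 3 ≤ F.acceptProbOn 0 (f x)) ∧ (x ∉ L → F.acceptProbOn 0 (f x) ≤ 1 / 3)) ∧ L ∉ Literature.Computability.Complexity.Classes.P

-- TODO item stmt-QuantumAdvantage-17622 · support · rank 5 · open · by planner — BLOCKED: missing decl(s) Function.circuitSize; restate via `ledger route edit` once they land:
--   def YbEHard : Prop := ∃ L ∈ Literature.Computability.Complexity.E, ∃ ε : ℝ, 0 < ε ∧ ∀ᶠ n : ℕ in Filter.atTop, (2 : ℝ) ^ (ε * n) ≤ (L.circuitSize n : ℝ)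

-- TODO item stmt-QuantumAdvantage-17625 · support · rank 9 · open · by planner — BLOCKED: missing decl(s) YbEHard; restate via `ledger route edit` once they land:
--   def YbDerandomizationGlue : Prop := YbEHard → YbNotP → YbTarget

/-- item stmt-QuantumAdvantage-2550 · support · rank 9 · open · by planner
why it might fail: Only bookkeeping can fail: uniformity of the composite family (f's machine + gate words) and the wire-0 convention; mathematically XXZBQP ⊆ BQP is not in doubt.
sources: DawsonNielsen2006, NielsenChuang2010, Watrous2009, BernsteinVazirani1997
[support] XXZBQP ⊆ BQP: given (a, b, f, p, q) build a uniform Clifford+T family: compute y = f(x)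
reversibly on ancillas (P ⊆ BQP plumbing, Literature.Computability.Cryptography.P_subset_BQP / the
Shor route's crux 5), run the brickwork with each U(a,b) (algebraic entries in a cyclotomic field:
cos 2aπ, sin 2aπ, e^{±ibπ}) replaced by a Clifford+T word of accuracy 2^{-k}, k = O(log(N q)) (a
sound GateCompiler in the sense of
Literature.Computability.QuantumComplexity.BQPWith_subset_BQPWith_of_compiler; Solovay–Kitaev,
DawsonNielsen2006), swap the brickwork's wire 0 onto the family's wire 0, absorb the extra 1/12
error by BQP_eq_BQPWith_holds. Routine but formalisation-heavy; needed by YbAssembly. [Objects,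
inlined verbatim in every signature; definition request IntegrableBrickwork mirrors them] U(a,b) :=
exp(-i(aπ(X⊗X+Y⊗Y)+bπ Z⊗Z)) (rows/cols indexed by Fin 2 → Bool; |00⟩,|11⟩ ↦ e^{-ibπ}, odd block
e^{ibπ}[[cos 2aπ, -i sin 2aπ],[-i sin 2aπ, cos 2aπ]]); gate set ⟨Unit, 2, U(a,b)⟩; brickwork(N,t) :=
layers s < t, layer s = gate on bonds (j,j+1) with j ≡ s mod 2, j+1 < N (open chain); family
F(a,b,p,q) := ⟨p.eval, n ↦ brickwork(n + p n, q n)⟩ : QCircuitFamily; XXZBQP := {L | ∃ a b : ℚ, -/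
@[route_item "route-QuantumAdvantage-YangBaxterIslands", crux]
def YbMembership : Prop :=
  {L : Language Bool | ∃ a b : ℚ, ∃ (f : List Bool → List Bool) (p q : Polynomial ℕ), f ∈ Literature.Computability.Complexity.FP ∧ ∃ F : Literature.Computability.Cryptography.QCircuitFamily (⟨Unit, fun _ => 2, fun _ => Matrix.of fun u v : Fin 2 → Bool => if u 0 = u 1 then (if v = u then Complex.exp (-((((b : ℝ) * Real.pi) : ℝ) : ℂ) * Complex.I) else 0) else if v 0 = v 1 then 0 else Complex.exp (((((b : ℝ) * Real.pi) : ℝ) : ℂ) * Complex.I) * (if v = u then ((Real.cos (2 * ((a : ℝ) * Real.pi)) : ℝ) : ℂ) else -(Complex.I * ((Real.sin (2 * ((a : ℝ) * Real.pi)) : ℝ) : ℂ)))⟩ : Literature.Computability.Cryptography.QGateSet), F = ⟨fun n => p.eval n, fun n => ⟨(List.range (q.eval n)).flatMap fun s => (List.range (n + p.eval n)).filterMap fun j => if h : j % 2 = s % 2 ∧ j + 1 < (n + p.eval n) then some (Literature.Computability.Cryptography.QGate.gate () ⟨fun i : Fin 2 => ⟨j + i.val, by have := i.isLt; omega⟩,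 fun i i' hh => Fin.ext (by simp only [Fin.mk.injEq] at hh; omega)⟩) else none⟩⟩ ∧ ∀ x : List Bool, (x ∈ L → (2 : ℝ) / 3 ≤ F.acceptProbOn 0 (f x)) ∧ (x ∉ L → F.acceptProbOn 0 (f x) ≤ 1 / 3)} ⊆ Literature.Computability.Cryptography.BQP

/-- item stmt-QuantumAdvantage-2551 · support · rank 9 · open · by planner
sources: BernsteinVazirani1997
[support] YbHardness → QuantumAdvantage → YbTarget: if BQP ⊆ XXZBQP and ⟨L, hL ∈ BQP, hL ∉ BPP⟩
witnesses the summit then ⟨L, Hardness hL, _⟩ witnesses X. Pure logic (term: fun hH ⟨L, hL, hL'⟩ =>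
⟨L, hH hL, hL'⟩); records that under YbHardness the thesis X is EQUIVALENT to S (with
YbAssembly/YbMembership for the other direction), i.e. X is not a gratuitous strengthening. -/
@[route_item "route-QuantumAdvantage-YangBaxterIslands"]
def YbHardnessTransfer : Prop :=
  YbHardness → QuantumAdvantage → YbTarget

/-- item stmt-QuantumAdvantage-2552 · support · rank 9 · open · by planner
why it might fail: Rounding real cores inside a Boolean circuit needs the entry-height clause of YbDiagTT (included); residual risk is only the P/poly plumbing for f and iterated dyadic matrix products.
sources: Oseledets2011, AroraBarak2009
[support] YbDiagTT → XXZBQP ⊆ P/poly (the NON-UNIFORM island). Proof sketch: fix L ∈ XXZBQP via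
(a,b,f,p,q); for input length n the advice is, for every m ≤ (length bound of f on inputs of length
n), the tensor-train cores of YbDiagTT for N = m + p(m), t = q(m), precision e = 11 (sup error ≤
1/12), with entries rounded to 2^{-s} for s = poly(n) chosen from the entry-height bound (|entries|
≤ 2^{r}, so a product of N matrices of size ≤ r+1 changes by ≤ N (r+1)^N 2^{rN} 2^{-s} under
rounding); the circuit computes f(x) (FP ⊆ P/poly), pads with zeros, multiplies the N selected
(D+1)×(D+1) dyadic matrices and compares the (0,0) entry with 1/2: ≥ 7/12 − 1/24 on yes-instances, ≤
5/12 + 1/24 on no-instances. Uses Literature.Computability.Complexity.PPoly (B₂ circuits) and P ⊆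
P/poly from CircuitClasses. This is the statement that makes YbDiagTT an engine; the UNIFORM version
(cores computable in poly time ⟹ XXZBQP ⊆ P) is deliberately not filed yet. -/
@[route_item "route-QuantumAdvantage-YangBaxterIslands"]
def YbDiagTTToPPoly : Prop :=
  YbDiagTT → {L : Language Bool | ∃ a b : ℚ, ∃ (f : List Bool → List Bool) (p q : Polynomial ℕ), f ∈ Literature.Computability.Complexity.FP ∧ ∃ F : Literature.Computability.Cryptography.QCircuitFamily (⟨Unit, fun _ => 2, fun _ => Matrix.of fun u v : Fin 2 → Bool => if u 0 = u 1 then (if v = u then Complex.exp (-((((b : ℝ) * Real.pi) : ℝ) : ℂ) * Complex.I) else 0) else if v 0 = v 1 then 0 else Complex.exp (((((b : ℝ) * Real.pi) : ℝ) : ℂ) * Complex.I) * (if v = u then ((Real.cos (2 * ((a : ℝ) * Real.pi)) : ℝ) : ℂ) else -(Complex.I * ((Real.sin (2 * ((a : ℝ) * Real.pi)) : ℝ) : ℂ)))⟩ : Literature.Computability.Cryptography.QGateSet), F = ⟨fun n => p.eval n, fun n => ⟨(List.range (q.eval n)).flatMap fun s => (List.range (n + p.eval n)).filterMap fun j =>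 if h : j % 2 = s % 2 ∧ j + 1 < (n + p.eval n) then some (Literature.Computability.Cryptography.QGate.gate () ⟨fun i : Fin 2 => ⟨j + i.val, by have := i.isLt; omega⟩, fun i i' hh => Fin.ext (by simp only [Fin.mk.injEq] at hh; omega)⟩) else none⟩⟩ ∧ ∀ x : List Bool, (x ∈ L → (2 : ℝ) / 3 ≤ F.acceptProbOn 0 (f x)) ∧ (x ∉ L → F.acceptProbOn 0 (f x) ≤ 1 / 3)} ⊆ Literature.Computability.Complexity.PPoly

/-- item stmt-QuantumAdvantage-2553 · support · rank 9 · open · by planner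
why it might fail: A theorem in print; only the formal cost (exact cyclotomic arithmetic on a TM2/WordRAM, the FP encoder) can stall it.
sources: Valiant2002, TerhalDivincenzo2002, JozsaMiyake2008
[support] FREE-FERMION LINE: for b ∈ ½ℤ (φ = bπ ∈ (π/2)ℤ, Δ = 0) every XXZBQPAt a b language is in
P. The gate is a nearest-neighbour MATCHGATE (even block e^{-ibπ}·1, odd block e^{ibπ}R(2aπ), equal
determinants iff e^{4ibπ} = 1), so by Jordan–Wigner (wire 0 = first site, no string) U†n₀U = Σ_{jl}
ū_{0j}u_{0l} c_j†c_l with u the N×N single-particle propagator (product of the layer matrices of 2×2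
blocks [[cos 2aπ, −i sin 2aπ],[−i sin 2aπ, cos 2aπ]] and signs from the Pauli ZZ factors when b is a
half-odd integer), hence acceptProb(z) = Σ_j |u_{0j}|² z_j EXACTLY; with a rational, all quantities
live in a cyclotomic field and are computed exactly in poly(N, t) time; decide by comparing with 1/2
after computing f(x). [Valiant2002 Thm 1–2; TerhalDivincenzo2002; JozsaMiyake2008 Thm 1 (n.n.
matchgates, product input, single-qubit output)]. Calibrates the inlined definitions (a wrong index
convention would show here first). [Objects, inlined verbatim in every signature; definition request
IntegrableBrickwork mirrors them] U(a,b) := exp(-i(aπ(X⊗X+Y⊗Y)+bπ Z⊗Z)) (rows/cols indexed by Fin 2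
→ Bool; |00⟩,|11⟩ ↦ e^{-ibπ}, odd block e^{ibπ}[[cos 2aπ, -i sin 2aπ],[-i sin 2aπ, cos 2aπ]]); gate
set -/
@[route_item "route-QuantumAdvantage-YangBaxterIslands"]
def YbFreeFermionLine : Prop :=
  {L : Language Bool | ∃ a b : ℚ, (∃ k : ℤ, (b : ℚ) = k / 2) ∧ ∃ (f : List Bool → List Bool) (p q : Polynomial ℕ), f ∈ Literature.Computability.Complexity.FP ∧ ∃ F : Literature.Computability.Cryptography.QCircuitFamily (⟨Unit, fun _ => 2, fun _ => Matrix.of fun u v : Fin 2 → Bool => if u 0 = u 1 then (if v = u then Complex.exp (-((((b : ℝ) * Real.pi) : ℝ) : ℂ) * Complex.I) else 0) else if v 0 = v 1 then 0 else Complex.exp (((((b : ℝ) * Real.pi) : ℝ) : ℂ) * Complex.I) * (if v = u then ((Real.cos (2 * ((a : ℝ) * Real.pi)) : ℝ) : ℂ) else -(Complex.I * ((Real.sin (2 * ((a : ℝ) * Real.pi)) : ℝ) : ℂ)))⟩ : Literature.Computability.Cryptography.QGateSet), F = ⟨fun n => p.eval n, fun n => ⟨(List.range (q.eval n)).flatMap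 fun s => (List.range (n + p.eval n)).filterMap fun j => if h : j % 2 = s % 2 ∧ j + 1 < (n + p.eval n) then some (Literature.Computability.Cryptography.QGate.gate () ⟨fun i : Fin 2 => ⟨j + i.val, by have := i.isLt; omega⟩, fun i i' hh => Fin.ext (by simp only [Fin.mk.injEq] at hh; omega)⟩) else none⟩⟩ ∧ ∀ x : List Bool, (x ∈ L → (2 : ℝ) / 3 ≤ F.acceptProbOn 0 (f x)) ∧ (x ∉ L → F.acceptProbOn 0 (f x) ≤ 1 / 3)} ⊆ Literature.Computability.Complexity.Classes.P

/-- item stmt-QuantumAdvantage-2554 · support · rank 9 · open · by planner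
why it might fail: Cannot fail mathematically; formal cost only (tracking a permutation of wires through List.flatMap/filterMap layers and the FP encoder on a TM).
sources: SuzukiMitaraiFujii2022, LjubotinaZadnikProsen2019
[support] TRIVIAL LINES: (i) a ∈ ½ℤ: sin 2aπ = 0, the gate is DIAGONAL, U_t|z⟩ = phase·|z⟩,
acceptProb(z) = [z_0 = 1], so the language is {x : (f x)_0 = 1} ∈ P; (ii) a ∈ ¼ + ½ℤ: cos 2aπ = 0,
the gate is SWAP up to phases (the dual-unitary line of the XXZ family), U_t|z⟩ = phase·|π_{N,t}(z)⟩
for the wire permutation π_{N,t} composed of the layer transpositions, acceptProb(z) =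
z_{π^{-1}(0)}, computable in poly time; language ∈ P. Elementary; exercises placeGate/acceptProb on
the inlined brickwork and is the cheapest end-to-end check of the definitions. [Objects, inlined
verbatim in every signature; definition request IntegrableBrickwork mirrors them] U(a,b) :=
exp(-i(aπ(X⊗X+Y⊗Y)+bπ Z⊗Z)) (rows/cols indexed by Fin 2 → Bool; |00⟩,|11⟩ ↦ e^{-ibπ}, odd block
e^{ibπ}[[cos 2aπ, -i sin 2aπ],[-i sin 2aπ, cos 2aπ]]); gate set ⟨Unit, 2, U(a,b)⟩; brickwork(N,t) :=
layers s < t, layer s = gate on bonds (j,j+1) with j ≡ s mod 2, j+1 < N (open chain); family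
F(a,b,p,q) := ⟨p.eval, n ↦ brickwork(n + p n, q n)⟩ : QCircuitFamily; XXZBQP := {L | ∃ a b : ℚ, ∃ f
∈ FP, ∃ p q : ℕ[X], ∀ x, F.acceptProbOn 0 (f x) ≥ 2/3 if x ∈ L, ≤ 1/3 if x ∉ L} (run on |f x⟩|0^{p|f
x|}⟩, wire 0 measured). Integrability: U( -/
@[route_item "route-QuantumAdvantage-YangBaxterIslands"]
def YbTrivialLines : Prop :=
  {L : Language Bool | ∃ a b : ℚ, ((∃ k : ℤ, (a : ℚ) = k / 2) ∨ ∃ k : ℤ, (a : ℚ) = k / 2 + 1 / 4) ∧ ∃ (f : List Bool → List Bool) (p q : Polynomial ℕ), f ∈ Literature.Computability.Complexity.FP ∧ ∃ F : Literature.Computability.Cryptography.QCircuitFamily (⟨Unit, fun _ => 2, fun _ => Matrix.of fun u v : Fin 2 → Bool => if u 0 = u 1 then (if v = u then Complex.exp (-((((b : ℝ) * Real.pi) : ℝ) : ℂ) * Complex.I) else 0) else if v 0 = v 1 then 0 else Complex.exp (((((b : ℝ) * Real.pi) : ℝ) : ℂ) * Complex.I) * (if v = u then ((Real.cos (2 *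 ((a : ℝ) * Real.pi)) : ℝ) : ℂ) else -(Complex.I * ((Real.sin (2 * ((a : ℝ) * Real.pi)) : ℝ) : ℂ)))⟩ : Literature.Computability.Cryptography.QGateSet), F = ⟨fun n => p.eval n, fun n => ⟨(List.range (q.eval n)).flatMap fun s => (List.range (n + p.eval n)).filterMap fun j => if h : j % 2 = s % 2 ∧ j + 1 < (n + p.eval n) then some (Literature.Computability.Cryptography.QGate.gate () ⟨fun i : Fin 2 => ⟨j + i.val, by have := i.isLt; omega⟩, fun i i' hh => Fin.ext (by simp only [Fin.mk.injEq] at hh; omega)⟩) else none⟩⟩ ∧ ∀ x : List Bool, (x ∈ L → (2 : ℝ) / 3 ≤ F.acceptProbOn 0 (f x)) ∧ (x ∉ L → F.acceptProbOn 0 (f x) ≤ 1 / 3)} ⊆ Literature.Computability.Complexity.Classes.P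

/-- item stmt-QuantumAdvantage-2546 · assembly · rank 1 · open · by planner
sources: BernsteinVazirani1997
[assembly] YbMembership → YbTarget → QuantumAdvantage: from L ∈ XXZBQP ⊆ BQP and L ∉ BPP get the
summit witness ⟨L, _, _⟩ (QuantumAdvantage := ∃ L, L ∈ BQP ∧ L ∉ BPP). Pure logic (term: fun hM ⟨L,
hL, hL'⟩ => ⟨L, hM hL, hL'⟩, checked in the planner's sketch); the content is in YbMembership and in
the fork YbHardness / YbIsland. -/
@[route_item "route-QuantumAdvantage-YangBaxterIslands"]
def YbAssembly : Prop :=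
  YbMembership → YbTarget → QuantumAdvantage

/-! D-0027 §2.1 — DECIDING THEOREM (planner-authored via `route open/edit --closes-file`; by planner-rbadge-QuantumAdvantage-YangBaxterIsla-3811562e-g2-0 2026-08-15T16:09:12Z):
its hypotheses are this route's items and its conclusion the sub-problem Statement (glue_lint), and it elaborates with this file. -/

@[closes "route-QuantumAdvantage-YangBaxterIslands"] theorem closes (hM : YbMembership) (hT : YbTarget) : QuantumAdvantage := by
  obtain ⟨L, hL, hL'⟩ := hT
  exact ⟨L, hM hL, hL'⟩

end Summit.QuantumAdvantage.QuantumAdvantage.Theses.YangBaxterIslands
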